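import Literature.AnabelianGeometry.AbsoluteAnabelian.AbsTopII.InertiaDecompositionCore
import Literature.AnabelianGeometry.AbsoluteAnabelian.AbsTopII.DecompositionGroups
import Literature.AnabelianGeometry.AbsoluteAnabelian.AbsTopII.InertiaGroups

/-!
# [AbsTopII] Prop 1.3 (iii): "`I_v ∩ Π_𝔾 = {1}`", "`D_v ∩ Π_I = I_v × Π_v`", "`I_e × I_v ⥲ D_e ∩ Π_I`" PROVED from the printed inputs

S. Mochizuki, *Topics in Absolute Anabelian Geometry II* [AbsTopII] (bib `MochizukiAbsTopII2013`;
locators = PDF pages of the kurims manuscript `paper:url-585b8d0ad0d9`), §1, Proposition 1.3 (iii)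
p. 11; proof p. 13:

  "Since `Π_v` is slim [cf., e.g., [Mzk13], Remark 1.1.3] and commensurably terminal in `Π_𝔾` [cf.
  [Mzk13], Proposition 1.2, (ii)], it follows that `D_v ∩ Π_𝔾 = Π_v` and `I_v ∩ Π_𝔾 = {1}`, so we
  obtain a natural injection `I_v ↪ I`. The fact that this injection is, in fact, surjective is
  immediate from the definitions when `X` is smooth over `k` and follows from the computation of
  '`I_v`' performed in the proof of assertion (ii) when `X` is singular. Next, let us observe that
  since `I_v` commutes [by definition!] with `Π_v`, we obtain a natural morphism `I_v × Π_v → D_v ∩ Π_I`,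
  which is both injective [since `I_v ∩ Π_v = {1}`] and surjective [cf. the isomorphism `I_v ⥲ I`;
  the fact that `D_v ∩ Π_𝔾 = Π_v`]. Now suppose that `e` is a cusp that abuts to `v`. Then [for
  appropriate choices of conjugates] it follows immediately from the definitions that we have
  inclusions `I_e, I_v ⊆ D_e ∩ Π_I`, and that `I_e` commutes with `I_v`. Note, moreover, that
  `D_e ∩ Π_𝔾 = I_e` [cf. [Mzk13], Proposition 1.2, (ii)]. Thus, the fact that the natural projection
  `I_v → I` is an isomorphism implies that we have a natural exact sequence
  `1 → I_e → D_e ∩ Π_I → I → 1`, and that the natural morphism `I_e × I_v → D_e ∩ Π_I` is an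
  isomorphism."

GEOMETRIC INPUTS (explicit hypotheses below): `Π_v` slim ([CombGC] Rmk 1.1.3), `Π_v`, `Π_e`
commensurably terminal in `Π_𝔾` ([CombGC] Prop 1.2 (ii)), the SURJECTIVITY `I_v · Π_𝔾 = Π_I`
("immediate from the definitions" / the computation of (ii)), `I_v ≅ Ẑ^Σ`, and for a cusp `e`
abutting to `v` the inclusion of an appropriate conjugate of `I_v` in `D_e ∩ Π_I` commuting with
`I_e`.  PROVED from them (pure group theory): `I_v ∩ Π_𝔾 = {1}` (`DPSCData.Iv_inf_PiG_eq_bot`), hence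
abc-iut-L4-t4's `DPSCData.Prop13iii` (FACT-LIST F-0275; `prop13iii_of_inputs`); the internal
products `D_v ∩ Π_I = I_v × Π_v` and `D_e ∩ Π_I = I_e × I_v`, hence abc-iut-L4-t6's
`DPSCIndexData.Prop_1_3_iii'` (F-0299; `prop_1_3_iii'_of_inputs`).  Proof-only, no definitions;
companion of `AbsTopII/InertiaDecompositionCore.lean` (SUBDAG `plan/L4/SUBDAG-AbsTopII-Prop13.md`).
HONEST FRAMING: classical group theory; the geometric inputs stay hypotheses (typed ≠ proved);
nothing here bears on [IUTchIII] Cor 3.12.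
-/

open scoped Pointwise

namespace Literature.AnabelianGeometry.AbsoluteAnabelian

open Literature.AlgebraicGeometry.Frobenioids (IsSlimGroup)

universe u

/-! ## Generic group theory -/

section GroupTheory

variable {G : Type u} [Group G]

/-- A slim group has trivial centre: its centraliser in an overgroup meets it trivially.
[cite: MochizukiCombGC2007, Rmk 1.1.3 p.7] -/
theorem centralizer_inf_self_eq_bot_of_isSlimGroup [TopologicalSpace G] {A : Subgroup G}
    (hslim : IsSlimGroup ↥A) : Subgroup.centralizer (A : Set G) ⊓ A = ⊥ := by
  rw [eq_bot_iff]
  intro x hx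
  obtain ⟨hxZ, hxA⟩ := Subgroup.mem_inf.mp hx
  rw [Subgroup.mem_centralizer_iff] at hxZ
  have htop : IsOpen (((⊤ : Subgroup ↥A) : Subgroup ↥A) : Set ↥A) := by
    rw [Subgroup.coe_top]; exact isOpen_univ
  have h1 := hslim.centralizer_eq_bot ⊤ htop
  have hx : (⟨x, hxA⟩ : ↥A) ∈ Subgroup.centralizer (((⊤ : Subgroup ↥A) : Subgroup ↥A) : Set ↥A) := by
    rw [Subgroup.mem_centralizer_iff]
    rintro y -
    exact Subtype.ext (hxZ y y.2)
  rw [h1, Subgroup.mem_bot] at hx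
  rw [Subgroup.mem_bot]
  exact congrArg Subtype.val hx

/-- p. 13: "Since `Π_v` is slim and commensurably terminal in `Π_𝔾`, it follows that …
`I_v ∩ Π_𝔾 = {1}`" — `Z_G(A) ∩ N = 1` for `A ≤ N` slim and commensurably terminal in `N`
(`Z_G(A) ∩ N ⊆ C_G(A) ∩ N ⊆ A`, and `Z_G(A) ∩ A = Z(A) = 1`).
[cite: MochizukiAbsTopII2013, Prop 1.3 (iii) proof p.13] -/
theorem centralizer_inf_eq_bot_of_ctIn_of_isSlimGroup [TopologicalSpace G] {A N : Subgroup G}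
    (hCT : Subgroup.Commensurable.commensurator A ⊓ N ≤ A) (hslim : IsSlimGroup ↥A) :
    Subgroup.centralizer (A : Set G) ⊓ N = ⊥ := by
  rw [eq_bot_iff]
  intro x hx
  obtain ⟨hxZ, hxN⟩ := Subgroup.mem_inf.mp hx
  have hxA : x ∈ A := hCT ⟨(Subgroup.centralizer_le_normalizer _ |>.trans
    (Anabelioids.normalizer_le_commensurator A)) hxZ, hxN⟩
  have := centralizer_inf_self_eq_bot_of_isSlimGroup hslim
  rw [eq_bot_iff] at this
  exact this (Subgroup.mem_inf.mpr ⟨hxZ, hxA⟩)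

/-- If `I · N = M` (with `N` normal), `I ≤ D`, and `D ∩ N = P`, then `D ∩ M = I ⊔ P` ("surjective
[cf. the isomorphism `I_v ⥲ I`; the fact that `D_v ∩ Π_𝔾 = Π_v`]", p. 13).
[cite: MochizukiAbsTopII2013, Prop 1.3 (iii) proof p.13] -/
theorem inf_eq_sup_of_sup_eq {I D N M P : Subgroup G} [N.Normal] (hIN : I ⊔ N = M) (hID : I ≤ D)
    (hDN : D ⊓ N = P) (hNM : N ≤ M) : D ⊓ M = I ⊔ P := by
  apply le_antisymm
  · intro x hx
    obtain ⟨hxD, hxM⟩ := Subgroup.mem_inf.mp hx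
    rw [← hIN, Subgroup.mem_sup_of_normal_right] at hxM
    obtain ⟨i, hi, n, hn, rfl⟩ := hxM
    have hnD : n ∈ D := by
      have := D.mul_mem (D.inv_mem (hID hi)) hxD
      rwa [inv_mul_cancel_left] at this
    have hnP : n ∈ P := by rw [← hDN]; exact ⟨hnD, hn⟩
    exact Subgroup.mul_mem_sup hi hnP
  · have hP : P ≤ D ⊓ M := by
      rw [← hDN]; exact inf_le_inf_left D hNM
    exact sup_le (le_inf hID (le_trans le_sup_left (le_of_eq hIN))) hP

end GroupTheory

/-! ## Assembly at the DPSC data -/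

namespace DPSCData

variable (X : DPSCData.{u})

/-- **p. 13: "`I_v ∩ Π_𝔾 = {1}`" PROVED** from "`Π_v` is slim and commensurably terminal in `Π_𝔾`"
(with the REAL `I_v := Z_{Π_I}(Π_v)`). [cite: MochizukiAbsTopII2013, Prop 1.3 (iii) proof p.13] -/
theorem Iv_inf_PiG_eq_bot (hCTv : ∀ v : X.Vert, IsCommensurablyTerminal ((X.vertSub v).subgroupOf X.PiG))
    (hslim : ∀ v : X.Vert, IsSlimGroup ↥(X.vertSub v)) (v : X.Vert) : X.Iv v ⊓ X.PiG = ⊥ := by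
  have hCT : Subgroup.Commensurable.commensurator (X.vertSub v) ⊓ X.PiG ≤ X.vertSub v :=
    (isCommensurablyTerminal_subgroupOf_iff (X.vertSub_le v)).mp (hCTv v)
  have h := centralizer_inf_eq_bot_of_ctIn_of_isSlimGroup hCT (hslim v)
  rw [eq_bot_iff] at h ⊢
  intro x hx
  obtain ⟨hxI, hxG⟩ := Subgroup.mem_inf.mp hx
  exact h (Subgroup.mem_inf.mpr ⟨(Subgroup.mem_inf.mp hxI).1, hxG⟩)

/-- **[AbsTopII] Prop 1.3 (iii), first clause as typed** (`DPSCData.Prop13iii`, F-0275: "natural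
isomorphism `I_v ⥲ I`", i.e. `I_v ∩ Π_𝔾 = 1` and `I_v · Π_𝔾 = Π_I`) from its printed inputs:
injectivity PROVED from slimness + commensurable terminality of `Π_v`; surjectivity ("immediate from
the definitions when `X` is smooth …; from the computation of (ii) when `X` is singular") is the
verbatim hypothesis `hsurj`. [cite: MochizukiAbsTopII2013, Prop 1.3 (iii) p.11] -/
theorem prop13iii_of_inputs
    (hCTv : ∀ v : X.Vert, IsCommensurablyTerminal ((X.vertSub v).subgroupOf X.PiG))
    (hslim : ∀ v : X.Vert, IsSlimGroup ↥(X.vertSub v))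
    (hsurj : ∀ v : X.Vert, X.Iv v ⊔ X.PiG = X.PiI) : X.Prop13iii :=
  fun v => ⟨X.Iv_inf_PiG_eq_bot hCTv hslim v, hsurj v⟩

/-- **p. 13: "`I_v × Π_v → D_v ∩ Π_I` … is both injective [since `I_v ∩ Π_v = {1}`] and surjective
[cf. the isomorphism `I_v ⥲ I`; the fact that `D_v ∩ Π_𝔾 = Π_v`]"** — `D_v ∩ Π_I` is the internal
direct product of `I_v` and `Π_v`, PROVED from slimness + commensurable terminality of `Π_v` and the
surjectivity `I_v · Π_𝔾 = Π_I`. [cite: MochizukiAbsTopII2013, Prop 1.3 (iii) proof p.13] -/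
theorem isInternalProduct_Iv_vertSub
    (hCTv : ∀ v : X.Vert, IsCommensurablyTerminal ((X.vertSub v).subgroupOf X.PiG))
    (hslim : ∀ v : X.Vert, IsSlimGroup ↥(X.vertSub v))
    (hsurj : ∀ v : X.Vert, X.Iv v ⊔ X.PiG = X.PiI) (v : X.Vert) :
    AbsTopII.IsInternalProduct (X.Iv v) (X.vertSub v) (X.Dv v ⊓ X.PiI) := by
  haveI : X.PiG.Normal := X.normal_PiG
  have hCT : Subgroup.Commensurable.commensurator (X.vertSub v) ⊓ X.PiG ≤ X.vertSub v :=
    (isCommensurablyTerminal_subgroupOf_iff (X.vertSub_le v)).mp (hCTv v)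
  have hDN : X.Dv v ⊓ X.PiG = X.vertSub v := normalizer_inf_eq_of_ctIn (X.vertSub_le v) hCT
  have hID : X.Iv v ≤ X.Dv v := le_trans inf_le_left (Subgroup.centralizer_le_normalizer _)
  refine ⟨le_inf hID inf_le_right, le_inf Subgroup.le_normalizer (le_trans (X.vertSub_le v) X.PiG_le_PiI),
    ?_, ?_, ?_⟩
  · intro a ha b hb
    have haZ : a ∈ Subgroup.centralizer (X.vertSub v : Set X.PiH) := ha.1
    rw [Subgroup.mem_centralizer_iff] at haZ
    exact (haZ b hb).symm
  · have h := X.Iv_inf_PiG_eq_bot hCTv hslim v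
    rw [eq_bot_iff] at h ⊢
    exact le_trans (inf_le_inf_left _ (X.vertSub_le v)) h
  · exact (inf_eq_sup_of_sup_eq (hsurj v) hID hDN X.PiG_le_PiI).symm

/-- **p. 13, cusp `e` abutting to `v`: "`1 → I_e → D_e ∩ Π_I → I → 1`" and "`I_e × I_v → D_e ∩ Π_I`
is an isomorphism"** PROVED from: `Π_e` commensurably terminal in `Π_𝔾` (`D_e ∩ Π_𝔾 = I_e`), the
isomorphism `I_v ⥲ I` (`I_v ∩ Π_𝔾 = 1`, `I_v · Π_𝔾 = Π_I`), and the printed "immediate from the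
definitions" inputs: an (appropriate) conjugate `J = g·I_v·g⁻¹` lies in `D_e ∩ Π_I` and commutes with
`I_e`. [cite: MochizukiAbsTopII2013, Prop 1.3 (iii) proof p.13] -/
theorem isInternalProduct_IvCusp
    (hCTc : ∀ e : X.Cusp, IsCommensurablyTerminal ((X.cuspSub e).subgroupOf X.PiG))
    (h13iii : X.Prop13iii) (e : X.Cusp) (g : X.PiH)
    (hle : MulAut.conj g • X.Iv (X.cuspVert e) ≤ X.DvCusp e ⊓ X.PiI)
    (hcomm : ∀ a ∈ X.IvCusp e, ∀ b ∈ MulAut.conj g • X.Iv (X.cuspVert e), a * b = b * a) :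
    AbsTopII.IsInternalProduct (X.IvCusp e) (MulAut.conj g • X.Iv (X.cuspVert e)) (X.DvCusp e ⊓ X.PiI) ∧
      (X.DvCusp e ⊓ X.PiI) ⊓ X.PiG = X.IvCusp e ∧ (X.DvCusp e ⊓ X.PiI) ⊔ X.PiG = X.PiI := by
  haveI : X.PiG.Normal := X.normal_PiG
  haveI : X.PiI.Normal := X.normal_PiI
  set J := MulAut.conj g • X.Iv (X.cuspVert e) with hJ
  have hCT : Subgroup.Commensurable.commensurator (X.cuspSub e) ⊓ X.PiG ≤ X.cuspSub e :=
    (isCommensurablyTerminal_subgroupOf_iff (X.cuspSub_le e)).mp (hCTc e)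
  have hDN : X.DvCusp e ⊓ X.PiG = X.cuspSub e := normalizer_inf_eq_of_ctIn (X.cuspSub_le e) hCT
  -- the conjugate `J` of `I_v` still maps isomorphically onto `I`
  have hJG : J ⊓ X.PiG = ⊥ := by
    rw [hJ, ← Subgroup.Normal.conj_smul_eq_self g X.PiG, ← Subgroup.smul_inf,
      (h13iii (X.cuspVert e)).1, Subgroup.smul_bot]
  have hJsup : J ⊔ X.PiG = X.PiI := by
    rw [hJ, ← Subgroup.Normal.conj_smul_eq_self g X.PiG, ← Subgroup.smul_sup,
      (h13iii (X.cuspVert e)).2, Subgroup.Normal.conj_smul_eq_self]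
  have hJD : J ≤ X.DvCusp e := le_trans hle inf_le_left
  have hsup : X.DvCusp e ⊓ X.PiI = J ⊔ X.cuspSub e := inf_eq_sup_of_sup_eq hJsup hJD hDN X.PiG_le_PiI
  refine ⟨⟨le_inf Subgroup.le_normalizer (le_trans (X.cuspSub_le e) X.PiG_le_PiI), hle, hcomm, ?_, ?_⟩,
    ?_, ?_⟩
  · -- `I_e ∩ J ⊆ Π_𝔾 ∩ J = 1`
    rw [eq_bot_iff, ← hJG]
    exact le_inf inf_le_right (le_trans inf_le_left (X.cuspSub_le e))
  · change X.cuspSub e ⊔ J = _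
    rw [hsup, sup_comm]
  · rw [inf_assoc, inf_eq_right.mpr X.PiG_le_PiI, hDN]; rfl
  · apply le_antisymm (sup_le inf_le_right X.PiG_le_PiI)
    nth_rewrite 1 [← hJsup]
    exact sup_le_sup_right hle _

end DPSCData

namespace AbsTopII.DPSCIndexData

variable (X : DPSCIndexData.{u})

/-- **[AbsTopII] Prop 1.3 (iii) (rest) as typed** (`DPSCIndexData.Prop_1_3_iii'`, F-0299) from its
printed inputs: the internal products `D_v ∩ Π_I = I_v × Π_v` and `D_e ∩ Π_I = I_e × I_v` (cusp `e`)
and the exactness clauses PROVED (pure group theory); the remaining printed inputs are explicit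
hypotheses — slimness and commensurable terminality of `Π_v`, `Π_e` ([CombGC] Rmk 1.1.3, Prop 1.2
(ii)), the surjectivity `I_v · Π_𝔾 = Π_I`, `I_v ≅ Ẑ^Σ` ("as abstract profinite groups"), and for
each cusp an (appropriate) conjugate of `I_v` inside `D_e ∩ Π_I` commuting with `I_e` ("immediate from
the definitions"). [cite: MochizukiAbsTopII2013, Prop 1.3 (iii) p.11] -/
theorem prop_1_3_iii'_of_inputs
    (hCTv : ∀ v : X.Vert, IsCommensurablyTerminal ((X.vertSub v).subgroupOf X.PiG))
    (hCTc : ∀ e : X.Cusp, IsCommensurablyTerminal ((X.cuspSub e).subgroupOf X.PiG))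
    (hslim : ∀ v : X.Vert, IsSlimGroup ↥(X.vertSub v))
    (hsurj : ∀ v : X.Vert, X.Iv v ⊔ X.PiG = X.PiI)
    (hcyc : ∀ v : X.Vert, IsFreeProSigmaCyclic X.Sigma ↥(X.Iv v))
    (hcusp : ∀ e : X.Cusp, ∃ g : X.PiH,
      MulAut.conj g • X.Iv (X.cuspVert e) ≤ X.DvCusp e ⊓ X.PiI ∧
      ∀ a ∈ X.IvCusp e, ∀ b ∈ MulAut.conj g • X.Iv (X.cuspVert e), a * b = b * a) :
    X.Prop_1_3_iii' := by
  refine ⟨fun v => ⟨X.toDPSCData.isInternalProduct_Iv_vertSub hCTv hslim hsurj v, hcyc v⟩, fun e => ?_⟩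
  obtain ⟨g, hle, hcomm⟩ := hcusp e
  exact ⟨g, X.toDPSCData.isInternalProduct_IvCusp hCTc
    (X.toDPSCData.prop13iii_of_inputs hCTv hslim hsurj) e g hle hcomm⟩

end AbsTopII.DPSCIndexData

end Literature.AnabelianGeometry.AbsoluteAnabelian
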